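import Summits.Ventures.HodgeRepro.Night3GradedComm
import Summits.Ventures.HodgeRepro.Night3GSetFormModel
import Summits.Ventures.HodgeRepro.Night3GSetFormNondeg

/-!
# The concrete form is symmetric on every zero-sum corner product; `Λ` kills no Weil class; `H = W ⊕ W^⊥`

Blind re-derivation cell `pub-hodge-repro`, seat `night-3` (gen 6, rows A and C; NIGHT3.md §13.3, §13.5).  Imports
gen 6's `Night3GradedComm` (graded commutativity, the symmetry of `wedgeForm`), gen 5's `Night3GSetFormModel` (the
form `Qm hc hΦ a M = Qc hc hΦ (a M)` of the corner product `B_M`) and `Night3GSetFormNondeg` (non-degeneracy of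
`Qc` on the Weil space).  Namespace `HodgeRepro.Night3.GSetModel`.

* `Qc_comm`: `Qc a x y = (−1)^{n·n} · Qc a y x`; `Qc_isSymm_of_even` / `Qc_isAlt_of_odd`;
* `even_card_of_isZeroSumG`: a zero-sum multiset of CM types has an EVEN number of members (every embedding lies in
  exactly half of them);
* **`Qm_isSymm_of_isZeroSumG`**: on every zero-sum corner product the form `Q′ = ∫ x ∪ y ∪ Λ` of Lemma P step (2) is
  a SYMMETRIC bilinear form — as the route has it (LEMMA-L-P-v2.md step (2));
* `Qc_eq_zero_of_mul_Λc_eq_zero` / **`eq_zero_of_mem_weilSpace_of_mul_Λc_eq_zero`**: the Poincaré-pairing reading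
  `Q′(x, y) = ∫ x ∧ (y ∧ Λ)` — if `y ∧ Λ = 0` then `Q′(·, y) = 0`; hence the Lefschetz-type map `y ↦ y ∧ Λ` is
  INJECTIVE on the Weil space of a non-empty corner product (no Weil class is killed by `Λ`): the kernel form of `hQ`;
* `disjoint_weilSpace_orthogonal` / `nondegenerate_restrict_weilSpace` / **`isCompl_weilSpace_orthogonal`**: for a
  zero-sum (even-degree) corner product, `W ⊓ W^⊥ = 0` and `H^{|M|}(B_M) = W ⊕ W^⊥` for the orthogonal of the Weil
  space with respect to `Q′` (Mathlib's `isCompl_orthogonal_of_restrict_nondegenerate`).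

READING: `Alg` is not mentioned; nothing here closes S4 (hface stays the open input); `K = L = ℂ`; nothing here says
anything about the status of the Hodge conjecture for CM abelian varieties, which is NOT proved.
-/

set_option autoImplicit false
open Finset Module
open scoped Pointwise
namespace HodgeRepro.Night3.GSetModel

open HodgeRepro.CMHodgeOn ExteriorAlgebra HodgeRepro.Night3.GSet

variable {G : Type*} [Group G] [Fintype G] [DecidableEq G] [LinearOrder G]

/-! ### The symmetry of `Qc` and of `Qm` -/

section Symm

variable {c : G} (hc : IsComplexConj c) {Φ₀ : Finset G} (hΦ : IsCMType c Φ₀) {n : ℕ} (a : Fin n → G → ℂ)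

/-- `Qc a x y = (−1)^{n·n} · Qc a y x` (graded commutativity of `⋀^n`). -/
theorem Qc_comm (x y : Hn G n) : Qc hc hΦ a x y = (-1 : ℂ) ^ (n * n) * Qc hc hΦ a y x :=
  ExtTop.wedgeForm_comm _ _ _ _ _ _ x y

/-- For an even number of factors the concrete form is symmetric. -/
theorem Qc_isSymm_of_even (hn : Even n) : (Qc hc hΦ a).IsSymm :=
  ExtTop.wedgeForm_isSymm_of_even _ _ _ _ _ _ hn

/-- For an odd number of factors the concrete form is alternating. -/
theorem Qc_isAlt_of_odd (hn : Odd n) : (Qc hc hΦ a).IsAlt :=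
  ExtTop.wedgeForm_isAlt_of_odd _ _ _ _ _ _ hn

end Symm

omit [Fintype G] [LinearOrder G] in
/-- **A zero-sum multiset of CM types has an even number of members**: every embedding lies in exactly half of
them, `2 · #{T ∈ M : x ∈ T} = |M|`. -/
theorem even_card_of_isZeroSumG {c : G} {M : Multiset (Finset G)} (hM : IsZeroSumG c M) :
    Even (Multiset.card M) :=
  ⟨(M.filter fun T => (1 : G) ∈ T).card, by rw [← hM.2 1, two_mul]⟩

/-- **On every zero-sum corner product the form `Q′ = ∫ x ∪ y ∪ Λ` is SYMMETRIC**: the number of factors `|M|` is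
even, and `(−1)^{|M|·|M|} = 1`. -/
theorem Qm_isSymm_of_isZeroSumG {c : G} (hc : IsComplexConj c) {Φ₀ : Finset G} (hΦ : IsCMType c Φ₀)
    (a : ∀ M : Multiset (Finset G), Fin (Multiset.card M) → G → ℂ) {M : Multiset (Finset G)}
    (hM : IsZeroSumG c M) : (Qm hc hΦ a M).IsSymm :=
  Qc_isSymm_of_even hc hΦ (a M) (even_card_of_isZeroSumG hM)

/-! ### The Poincaré-pairing reading: `Λ` kills no Weil class -/

section Lefschetz

variable {c : G} (hc : IsComplexConj c) {Φ₀ : Finset G} (hΦ : IsCMType c Φ₀) {n : ℕ} (a : Fin n → G → ℂ)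

/-- `Q′(x, y) = ∫ x ∧ (y ∧ Λ)`: if `y ∧ Λ = 0` then `Q′(x, y) = 0` for every `x`. -/
theorem Qc_eq_zero_of_mul_Λc_eq_zero {y : Hn G n} (hy : (y : ExteriorAlgebra ℂ (V G n)) * Λc c Φ₀ a = 0)
    (x : Hn G n) : Qc hc hΦ a x y = 0 := by
  have h : (⟨(x : ExteriorAlgebra ℂ (V G n)) * y * Λc c Φ₀ a, ExtTop.mul_mul_mem x y (coe_Λc_mem c Φ₀ a)⟩ :
      ⋀[ℂ]^(n + n + 2 * (Φ₀.card - 1) * n) (V G n)) = 0 := by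
    ext
    simp only [Submodule.coe_zero]
    rw [mul_assoc, hy, mul_zero]
  rw [Qc_apply, h, map_zero]

include hc hΦ in
/-- **The Lefschetz-type map `y ↦ y ∧ Λ` is injective on the Weil space** of a non-empty corner product: a Weil
class killed by `Λ` pairs to `0` with every line, hence is `0` (`n ≥ 1`, non-vanishing coefficients). -/
theorem eq_zero_of_mem_weilSpace_of_mul_Λc_eq_zero (ha : ∀ i ρ, ρ ∈ Φ₀ → a i ρ ≠ 0) (hn : 0 < n)
    {y : Hn G n} (hy : y ∈ Submodule.span ℂ (Set.range (line (G := G) n)))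
    (hyΛ : (y : ExteriorAlgebra ℂ (V G n)) * Λc c Φ₀ a = 0) : y = 0 :=
  eq_zero_of_mem_span_line_of_forall_Qc_line_eq_zero hc hΦ a ha hn hy fun τ => by
    rw [Qc_comm hc hΦ a y (line n τ), Qc_eq_zero_of_mul_Λc_eq_zero hc hΦ a hyΛ, mul_zero]

end Lefschetz

/-! ### The orthogonal decomposition `H = W ⊕ W^⊥` for even degree -/

section Orthogonal

variable {c : G} (hc : IsComplexConj c) {Φ₀ : Finset G} (hΦ : IsCMType c Φ₀) (M : Multiset (Finset G))
  (a : Fin (Multiset.card M) → G → ℂ)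

/-- `W ⊓ W^⊥ = 0` for the Weil space of a non-empty corner product with an even number of factors. -/
theorem disjoint_weilSpace_orthogonal (hM : M ≠ 0) (hev : Even (Multiset.card M))
    (ha : ∀ i ρ, ρ ∈ Φ₀ → a i ρ ≠ 0) :
    Disjoint (weilSpace M) ((Qc hc hΦ a).orthogonal (weilSpace M)) := by
  rw [Submodule.disjoint_def]
  intro x hx hx'
  rw [LinearMap.BilinForm.mem_orthogonal_iff] at hx'
  refine eq_zero_of_mem_weilSpace_of_forall_Qc_line_eq_zero hc hΦ M hM a ha hx fun τ => ?_
  rw [(Qc_isSymm_of_even hc hΦ a hev).eq]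
  exact hx' _ (line_mem_weilSpace M τ)

/-- The restriction of `Q′` to the Weil space is non-degenerate (even degree, non-empty corner product). -/
theorem nondegenerate_restrict_weilSpace (hM : M ≠ 0) (hev : Even (Multiset.card M))
    (ha : ∀ i ρ, ρ ∈ Φ₀ → a i ρ ≠ 0) : ((Qc hc hΦ a).restrict (weilSpace M)).Nondegenerate :=
  LinearMap.BilinForm.nondegenerate_restrict_of_disjoint_orthogonal _ (Qc_isSymm_of_even hc hΦ a hev).isRefl
    (disjoint_weilSpace_orthogonal hc hΦ M a hM hev ha)

/-- **`H^{|M|}(B_M, ℂ) = W ⊕ W^⊥`**: for a non-empty corner product with an even number of factors, the Weil space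
and its `Q′`-orthogonal are complementary. -/
theorem isCompl_weilSpace_orthogonal (hM : M ≠ 0) (hev : Even (Multiset.card M))
    (ha : ∀ i ρ, ρ ∈ Φ₀ → a i ρ ≠ 0) :
    IsCompl (weilSpace M) ((Qc hc hΦ a).orthogonal (weilSpace M)) :=
  LinearMap.BilinForm.isCompl_orthogonal_of_restrict_nondegenerate (Qc_isSymm_of_even hc hΦ a hev).isRefl
    (nondegenerate_restrict_weilSpace hc hΦ M a hM hev ha)

/-- The same for every zero-sum corner product (even degree by `even_card_of_isZeroSumG`). -/
theorem isCompl_weilSpace_orthogonal_of_isZeroSumG (hM : M ≠ 0) (hz : IsZeroSumG c M)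
    (ha : ∀ i ρ, ρ ∈ Φ₀ → a i ρ ≠ 0) :
    IsCompl (weilSpace M) ((Qc hc hΦ a).orthogonal (weilSpace M)) :=
  isCompl_weilSpace_orthogonal hc hΦ M a hM (even_card_of_isZeroSumG hz) ha

end Orthogonal

end HodgeRepro.Night3.GSetModel
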